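import Literature.MathematicalPhysics.QuantumFieldTheory.Balaban1983to89.B5Eq129CoshWeightFactorLetters
import Literature.MathematicalPhysics.QuantumFieldTheory.Balaban1983to89.B9SectCLatticeCarrier

/-!
# `Balaban1983to89.B9Eq342GradientRowNaturalPerturbation` — T. Bałaban, *Propagators for lattice gauge theories in a background field*, Commun. Math. Phys.
# **99** (1985) 389–434 [Balaban1985BackgroundPropagators] Thm 3.1 (3.42) p. 397 (second entry, the covariant-gradient row), (3.23) p. 394 (the covariant
# Laplace operator), (3.35) p. 396 (the small-field gauge on a cube), (3.43) p. 398 (the cutoff); [Balaban1984PropagatorsI] p. 36 (the `cosh` weight):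
# **THE PERTURBATION LETTER OF THE GRADIENT-ROW BOOTSTRAP FROM A NATURAL STENCIL LETTER, IN THE WEIGHTED CURRENCY OF THE PURE-GAUGE RESPONSE MAP —
# a perturbation controlled at the site `y` by the covariant derivatives on the `2d` bonds at `y` (one coefficient `ε^nat`) plus a value term satisfies the
# `hV` binder of `B9Eq342GradientRowBootstrap.norm_le_of_gradient_response_bootstrap` for the bond weight `w′(x,ν) = B_ν·W_{x₀}(x + e_ν)` with
# `ε₁ = ε^nat·(e^{a} + 1)·Σ_ν B_ν` (`W_{x₀}` the product-`cosh` weight at rate `a`, whose one-step ratio on the periodic lattice is `≤ e^{a}`), and the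
# contraction binder `|t|·ε₁ < 1` is then met, for EVERY `t ≥ 1`, by ONE t-free choice of the comparison mass against the t-free letter `|t|·B_ν ≤ C ≤ K∕√m`**

statement-level skeleton of published theorems with citation tags; proofs where landed; nothing here is a claim about the Yang–Mills mass gap

CITATION HEADER (lean-in-tree rule).  Audit cell `pub-balaban`, sub-cell `t4`, BINDER row NE9; filed by NE9 crux-team LEAF PROVER 05
(`b2b-balaban-t4-ne9-formalise-leaf-05`, gen 84).  MATHEMATICS AND LEAN of §N ∕ §C ∕ §W ∕ §T: t4-ne9-idea-1 (NE9 crux ideation lens 1), gen 145, content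
note N46 `t4/ideate/NE9/lens1-g145/N46-SLOT-CURRENCY-g145.md` (fbff15ac5cbff8a6) and scratch kernel G `t4/ideate/NE9/lens1-g145/lean/NE9SlotCurrency.lean`
(0c1a13fc01118903; farm rc 0, axioms trio): `pert_of_natural`, `pert_of_natural_stencil`, `cosh_step_le`, `prod_cosh_step_le`, `exp_div_le_exp`,
`stencil_sum_le`, `pert_of_natural_lattice`, `theta_le`, `theta_le_half`, `weighted_junction_uniform` — PORTED (lemma bodies verbatim), CREDIT THEIRS (their
located remark L-g145-1 → this lineage, 2026-08-24T21:2xZ); kernel G's §R (the currency substitution `(S, w′, ε₀, ε₁) ↦ (S∕λ, λ·w′, ε₀∕λ, λ·ε₁)`, which fixes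
`θ = S·ε₁` and the output) is explanatory and is NOT ported.  §L (the
one-step ratio of the product-`cosh` weight on the chain's periodic lattice `TSite d N`, in the letter shapes of `B9Eq342GradientRowPureGauge`) and the `Bond d N`
specialisation `pert_of_natural_bond` are this lineage's plumbing («one-line torus lemmas for whoever instantiates», N46 §3).  SOURCE loci READ first-hand in the
held text layer [Balaban1985BackgroundPropagators] (`paper:balaban1985-cmp99-background-propagators`): p. 397 Thm 3.1 (3.42), p. 394 (3.23), p. 396 (3.35), p. 398
(3.43); [Balaban1984PropagatorsI] p. 36 (the weight) — cites only; [folklore] real arithmetic and torus-distance bookkeeping; nothing printed is a hypothesis.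

WHY THIS FILE (cell context).  Storey J of row L13 (the covariant-gradient row of a resolvent by the weighted sup-norm contraction): the bootstrap
`B9Eq342GradientRowBootstrap` §4 (tree) takes a RESPONSE letter `hT` (`S`, weights `w`, `w′`), a PERTURBATION letter
`hV : ∀ M ≥ 0, (∀ b, ‖D b‖ ≤ M·w′ b) → ∀ b y, ‖V b y‖ ≤ (ε₁·M + ε₂·N)·w y` and `hθ : S·ε₁ < 1`.  The pure-gauge junction `B9Eq342GradientRowPureGauge` §3
(this lineage, staged 025a81ea05e73518) places `S = |t|`, `w = W_{x₀}` (product-`cosh` at rate `a`, centre `x₀`) and `w′ b = B_{b.2}·W_{x₀}(b₊)`.  What an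
INSTANCE delivers (the cutoff commutator `B9Eq323KatoCutoffCommutator` §1 `norm_commutator_le`, the two-background remainder `B9Eq373KatoPairedRemainder`) is a
NATURAL letter: `‖V b y‖ ≤ ε^nat·Σ_ν(‖D(y,ν)‖ + ‖D(y − e_ν,ν)‖) + ε₂·N·W_{x₀}(y)`.  This file converts natural letters into `hV` for THAT `w′` and says which
`ε₁` results and why `hθ` is then t-free.

WHAT IS PROVED (sorry-free; 0 `def`; [folklore]).
* §N **`pert_of_natural`** (all bonds, coefficients `c_y(b′) ≥ 0`, comparability `Σ_{b′} c_y(b′)·w′ b′ ≤ ε₁·w y` ⟹ `hV`), **`pert_of_natural_stencil`**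
  (`c_y = ε^nat·1_{A(y)}`, `Σ_{b′ ∈ A(y)} w′ b′ ≤ ρ·w y` ⟹ `hV` with `ε₁ = ε^nat·ρ`).
* §C **`cosh_step_le`** (`0 ≤ a`, `|n′ − n| ≤ 1` ⟹ `cosh(a n′) ≤ e^{a}·cosh(a n)`), `prod_cosh_step_le` (product form, one profile moved), `exp_div_le_exp`
  (`e^{κ∕t} ≤ e^{κ}` for `t ≥ 1`, `κ ≥ 0`).
* §L on `TSite d N` (`N_μ ≥ 1`), `W_{x₀}(y) := Π_μ cosh(a·circAbs (N μ) ((x₀)_μ − y_μ).val)` WRITTEN OUT as in `B9Eq342GradientRowPureGauge`: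
  `cosh_factor_shift_le` ∕ `cosh_factor_unshift_le` (one factor, one step: `≤ e^{a}·`), **`weight_site_shift_le`** ∕ **`weight_site_unshift_le`**
  (`W_{x₀}(y ± e_ν) ≤ e^{a}·W_{x₀}(y)`), `weight_site_pos`.
* §W `stencil_sum_le`, **`pert_of_natural_lattice`** (abstract steps `sh`∕`ush` with `sh ν (ush ν y) = y`, bond weight `B b.2 * w (sh b.2 b.1)`, one-step
  ratio `w (sh ν y) ≤ γ·w y` ⟹ `hV` with `ε₁ = ε^nat·((γ + 1)·Σ_ν B_ν)`), **`pert_of_natural_bond`** (the chain's `Bond d N`, `btgt`, `W_{x₀}`, `γ = e^{a}`: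
  LITERALLY the `hV` binder of `B9Eq342GradientRowPureGauge.norm_le_of_gradient_response_bootstrap_pureGauge`).
* §T `theta_le`, `theta_le_half`, **`weighted_junction_uniform`** (`1 ≤ t`, `0 ≤ κ`, `0 ≤ ε^nat`, t-free letter `|t|·B_ν ≤ C ≤ K∕√m`, `0 < m`, mass choice
  `2·ε^nat·(e^{κ} + 1)·d·K ≤ √m` ⟹ `|t|·(ε^nat·((e^{κ∕t} + 1)·Σ_ν B_ν)) < 1`), `weighted_junction_uniform_complex` (the same with `‖(t : ℂ)‖`, the letter
  shape of `B9Eq342GradientRowPureGauge`).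
HONEST SCOPE.  Real arithmetic and torus-distance bookkeeping; the natural letters themselves (cutoff commutator, two-background remainder, the small-field gauge
letter of (3.35)) and the data ∕ representation binders are the consumer's; whether `ε^nat` is t-free is the INSTANCE question and is not touched; nothing of
Bałaban's Thm 3.1 asserted, valued or discharged.  NOT summit progress (cell pub-balaban: NE9 NOT PRINTED ∕ NOT PROVED; «NE9 ⇐ the named binders»; row
WALLED ON A MODEL (O-NE9-1; #5 UNRULED); spine PROVED 0∕9; rung (B)+1 finite T⁴ — NOT infinite volume, NOT mass gap, NOT BetaPertH, NOT Clay).  HONEST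
DEPENDENCY (cell line): continuum YM on T⁴ ⇐ BetaPertH ∧ nine spine estimates (0/9 proved); BetaPertH ⇐ (D1) ∧ (D4) ∧ CAP+tail; G-an2-4 gates asym, D1 and
NE2/3/4.  NEW file importing `B5Eq129CoshWeightFactorLetters` + `B9SectCLatticeCarrier`; nothing modified.  Net new unproved facts: 0.
-/

noncomputable section

open scoped BigOperators

namespace Literature.MathematicalPhysics.QuantumFieldTheory.Balaban1983to89.B9Eq342GradientRowNaturalPerturbation

open B4Sect5Torus (TSite)
open B9SectCLatticeCarrier (Bond btgt shift unshift shift_apply_val shift_apply_ne unshift_apply_val unshift_apply_ne shift_unshift)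
open B4TorusKernel.MultiPeriod (circAbs circAbs_nonneg circAbs_le_abs)
open B5G183FreeRowSum (circAbs_val_eq)
open B5Eq129CoshWeightFactorLetters (cosh_circAbs_add_le)

/-! ## §N Natural letter + comparability ⇒ the perturbation letter `hV` -/

section Natural

variable {X Y E : Type*} [SeminormedAddCommGroup E]

/-- **NATURAL LETTER + COMPARABILITY ⇒ (PERT)** (general linear form over all bonds, coefficients `c_y(b′) ≥ 0`): if
`‖V b y‖ ≤ Σ_{b′} c_y(b′)·‖D b′‖ + ε₂·N·w y` and `Σ_{b′} c_y(b′)·w′ b′ ≤ ε₁·w y`, then `V` satisfies the `hV` binder of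
`B9Eq342GradientRowBootstrap.norm_le_of_gradient_response_bootstrap` with that `ε₁`. (t4-ne9-idea-1 g145 kernel G `pert_of_natural`.) [folklore]
[cite: Balaban1985BackgroundPropagators, Thm 3.1 (3.42) p.397, (3.23) p.394] -/
theorem pert_of_natural [Fintype Y] (D : Y → E) (V : Y → X → E) (w : X → ℝ) (w' : Y → ℝ) (c : X → Y → ℝ)
    {ε₁ ε₂ N : ℝ} (hc : ∀ y b', 0 ≤ c y b')
    (hnat : ∀ b y, ‖V b y‖ ≤ (∑ b', c y b' * ‖D b'‖) + ε₂ * N * w y)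
    (hcmp : ∀ y, ∑ b', c y b' * w' b' ≤ ε₁ * w y) :
    ∀ M : ℝ, 0 ≤ M → (∀ b, ‖D b‖ ≤ M * w' b) → ∀ b y, ‖V b y‖ ≤ (ε₁ * M + ε₂ * N) * w y := by
  intro M hM hD b y
  have h1 : ∑ b', c y b' * ‖D b'‖ ≤ M * ∑ b', c y b' * w' b' := by
    rw [Finset.mul_sum]
    exact Finset.sum_le_sum fun b' _ =>
      calc c y b' * ‖D b'‖ ≤ c y b' * (M * w' b') := mul_le_mul_of_nonneg_left (hD b') (hc y b')
        _ = M * (c y b' * w' b') := by ring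
  have h2 : M * ∑ b', c y b' * w' b' ≤ M * (ε₁ * w y) := mul_le_mul_of_nonneg_left (hcmp y) hM
  calc ‖V b y‖ ≤ (∑ b', c y b' * ‖D b'‖) + ε₂ * N * w y := hnat b y
    _ ≤ M * (ε₁ * w y) + ε₂ * N * w y := by linarith
    _ = (ε₁ * M + ε₂ * N) * w y := by ring

/-- **STENCIL FORM**: one coefficient `ε^nat ≥ 0` on a finite set `A(y)` of bonds and the comparability `Σ_{b′ ∈ A(y)} w′ b′ ≤ ρ·w y` ⟹ `hV` with
`ε₁ = ε^nat·ρ`. (kernel G `pert_of_natural_stencil`.) [folklore] [cite: Balaban1985BackgroundPropagators, Thm 3.1 (3.42) p.397, (3.43) p.398] -/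
theorem pert_of_natural_stencil (D : Y → E) (V : Y → X → E) (w : X → ℝ) (w' : Y → ℝ) (A : X → Finset Y)
    {εn ρ ε₂ N : ℝ} (hεn : 0 ≤ εn)
    (hnat : ∀ b y, ‖V b y‖ ≤ εn * (∑ b' ∈ A y, ‖D b'‖) + ε₂ * N * w y)
    (hcmp : ∀ y, ∑ b' ∈ A y, w' b' ≤ ρ * w y) :
    ∀ M : ℝ, 0 ≤ M → (∀ b, ‖D b‖ ≤ M * w' b) → ∀ b y, ‖V b y‖ ≤ (εn * ρ * M + ε₂ * N) * w y := by
  intro M hM hD b y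
  have h1 : ∑ b' ∈ A y, ‖D b'‖ ≤ M * ∑ b' ∈ A y, w' b' := by
    rw [Finset.mul_sum]; exact Finset.sum_le_sum fun b' _ => hD b'
  have h2 : εn * ∑ b' ∈ A y, ‖D b'‖ ≤ εn * (M * (ρ * w y)) :=
    mul_le_mul_of_nonneg_left (h1.trans (mul_le_mul_of_nonneg_left (hcmp y) hM)) hεn
  calc ‖V b y‖ ≤ εn * (∑ b' ∈ A y, ‖D b'‖) + ε₂ * N * w y := hnat b y
    _ ≤ εn * (M * (ρ * w y)) + ε₂ * N * w y := by linarith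
    _ = (εn * ρ * M + ε₂ * N) * w y := by ring

end Natural

/-! ## §C One lattice step costs `e^{a}` on a `cosh` profile -/

section Cosh

/-- `cosh(a·n′) ≤ e^{a}·cosh(a·n)` for `|n′ − n| ≤ 1`, `0 ≤ a` (`cosh(x + δ) = cosh x·cosh δ + sinh x·sinh δ`, `|δ| ≤ a`, `|sinh x| ≤ cosh x`,
`cosh a + sinh a = e^{a}`). (kernel G `cosh_step_le`.) [folklore] [cite: Balaban1984PropagatorsI, p.36] -/
theorem cosh_step_le {a n n' : ℝ} (ha : 0 ≤ a) (h : |n' - n| ≤ 1) :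
    Real.cosh (a * n') ≤ Real.exp a * Real.cosh (a * n) := by
  have e : a * n' = a * n + a * (n' - n) := by ring
  have hδ : |a * (n' - n)| ≤ a := by
    rw [abs_mul, abs_of_nonneg ha]
    calc a * |n' - n| ≤ a * 1 := mul_le_mul_of_nonneg_left h ha
      _ = a := mul_one a
  have h1 : Real.cosh (a * (n' - n)) ≤ Real.cosh a := by
    rw [Real.cosh_le_cosh, abs_of_nonneg ha]; exact hδ
  have h2 : |Real.sinh (a * (n' - n))| ≤ Real.sinh a := by
    rw [Real.abs_sinh, Real.sinh_le_sinh]; exact hδ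
  have h3 : |Real.sinh (a * n)| ≤ Real.cosh (a * n) := by
    rw [Real.abs_sinh, ← Real.cosh_abs (a * n)]; exact (Real.sinh_lt_cosh _).le
  have hc : 0 < Real.cosh (a * n) := Real.cosh_pos _
  have h4 : Real.sinh (a * n) * Real.sinh (a * (n' - n)) ≤ Real.cosh (a * n) * Real.sinh a :=
    calc Real.sinh (a * n) * Real.sinh (a * (n' - n)) ≤ |Real.sinh (a * n) * Real.sinh (a * (n' - n))| := le_abs_self _
      _ = |Real.sinh (a * n)| * |Real.sinh (a * (n' - n))| := abs_mul _ _
      _ ≤ Real.cosh (a * n) * Real.sinh a := mul_le_mul h3 h2 (abs_nonneg _) hc.le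
  have h5 : Real.cosh (a * n) * Real.cosh (a * (n' - n)) ≤ Real.cosh (a * n) * Real.cosh a :=
    mul_le_mul_of_nonneg_left h1 hc.le
  rw [e, Real.cosh_add, ← Real.cosh_add_sinh a]
  calc Real.cosh (a * n) * Real.cosh (a * (n' - n)) + Real.sinh (a * n) * Real.sinh (a * (n' - n))
      ≤ Real.cosh (a * n) * Real.cosh a + Real.cosh (a * n) * Real.sinh a := add_le_add h5 h4
    _ = (Real.cosh a + Real.sinh a) * Real.cosh (a * n) := by ring

/-- PRODUCT FORM: a step changing ONE coordinate profile by at most `1` and fixing the others costs `e^{a}` on `Π_μ cosh(a·n_μ)`.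
(kernel G `prod_cosh_step_le`.) [folklore] [cite: Balaban1984PropagatorsI, p.36] -/
theorem prod_cosh_step_le {ι : Type*} [Fintype ι] [DecidableEq ι] {a : ℝ} (ha : 0 ≤ a) (n n' : ι → ℝ) (ν : ι)
    (hν : |n' ν - n ν| ≤ 1) (hoff : ∀ μ, μ ≠ ν → n' μ = n μ) :
    ∏ μ, Real.cosh (a * n' μ) ≤ Real.exp a * ∏ μ, Real.cosh (a * n μ) := by
  rw [← Finset.mul_prod_erase Finset.univ (fun μ => Real.cosh (a * n' μ)) (Finset.mem_univ ν),
    ← Finset.mul_prod_erase Finset.univ (fun μ => Real.cosh (a * n μ)) (Finset.mem_univ ν)]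
  have he : ∏ μ ∈ Finset.univ.erase ν, Real.cosh (a * n' μ) = ∏ μ ∈ Finset.univ.erase ν, Real.cosh (a * n μ) :=
    Finset.prod_congr rfl fun μ hμ => by rw [hoff μ (Finset.ne_of_mem_erase hμ)]
  rw [he, ← mul_assoc]
  exact mul_le_mul_of_nonneg_right (cosh_step_le ha hν) (Finset.prod_nonneg fun μ _ => (Real.cosh_pos _).le)

/-- the one-step ratio at the physical rate is t-free: `e^{κ∕t} ≤ e^{κ}` for `t ≥ 1`, `κ ≥ 0`. (kernel G `exp_div_le_exp`.) [folklore]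
[cite: Balaban1985BackgroundPropagators, Thm 3.1 (3.42) p.397] -/
theorem exp_div_le_exp {κ t : ℝ} (hκ : 0 ≤ κ) (ht : 1 ≤ t) : Real.exp (κ / t) ≤ Real.exp κ :=
  Real.exp_le_exp.mpr (div_le_self hκ ht)

end Cosh

/-! ## §L The product-`cosh` weight on the chain's periodic lattice `TSite d N`: one step costs `e^{a}` -/

section Lattice

/-- one factor, one step: `|d((c − (y + e)).val) − d((c − y).val)| ≤ 1` for `e = ±1`, `d = circAbs n` (triangle inequality for the torus distance,
`circAbs n (±1) ≤ 1`). [folklore] [cite: Balaban1984PropagatorsI, p.36] -/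
theorem abs_circAbs_val_sub_step_le {n : ℕ} [NeZero n] (c y e : ZMod n) (he : e = 1 ∨ e = -1) :
    |((circAbs n ((c - (y + e) : ZMod n).val) : ℤ) : ℝ) - ((circAbs n ((c - y : ZMod n).val) : ℤ) : ℝ)| ≤ 1 := by
  have hP : 1 ≤ n := Nat.one_le_iff_ne_zero.mpr (NeZero.ne _)
  set z : ℤ := (((c - y : ZMod n).val : ℕ) : ℤ) with hz
  have hzc : ((z : ℤ) : ZMod n) = c - y := by rw [hz, Int.cast_natCast, ZMod.natCast_zmod_val]
  obtain ⟨ei, hei, heabs⟩ : ∃ ei : ℤ, (ei : ZMod n) = e ∧ |ei| = 1 := by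
    rcases he with rfl | rfl
    · exact ⟨1, by push_cast; rfl, by simp⟩
    · exact ⟨-1, by push_cast; rfl, by simp⟩
  have e1 : circAbs n (((c - (y + e) : ZMod n).val : ℕ) : ℤ) = circAbs n (z + (-ei)) :=
    circAbs_val_eq _ _ (by push_cast; rw [hzc, hei]; ring)
  have hstep : ∀ u v : ℤ, |u| = 1 → circAbs n (v + u) ≤ circAbs n v + 1 := fun u v hu =>
    calc circAbs n (v + u) ≤ circAbs n v + circAbs n u := B4Sect5Torus.circAbs_add_le hP v u
      _ ≤ circAbs n v + |u| := by have := circAbs_le_abs hP u; omega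
      _ = circAbs n v + 1 := by rw [hu]
  have hup : circAbs n (z + (-ei)) ≤ circAbs n z + 1 := hstep (-ei) z (by rw [abs_neg, heabs])
  have hdn : circAbs n z ≤ circAbs n (z + (-ei)) + 1 := by
    have := hstep ei (z + (-ei)) heabs
    rwa [show z + (-ei) + ei = z by ring] at this
  rw [e1, abs_le]
  constructor
  · have : ((circAbs n z : ℤ) : ℝ) ≤ (circAbs n (z + (-ei)) : ℝ) + 1 := by exact_mod_cast hdn
    linarith
  · have : ((circAbs n (z + (-ei)) : ℤ) : ℝ) ≤ (circAbs n z : ℝ) + 1 := by exact_mod_cast hup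
    linarith

variable {d : ℕ} {N : Fin d → ℕ}

/-- the coordinate reading of the forward step: `((y + e_ν)_ν : ℤ∕N_ν) = (y_ν : ℤ∕N_ν) + 1` (re-derived from `B9SectCLatticeCarrier.shift_apply_val`;
cf. `B9Eq342CoshWeightSite.cast_shift`). [folklore] [cite: Balaban1985BackgroundPropagators, (3.1) p.390] -/
theorem cast_shift_self (ν : Fin d) (y : TSite d N) :
    (((shift ν y) ν : ℕ) : ZMod (N ν)) = ((y ν : ℕ) : ZMod (N ν)) + 1 := by
  rw [show ((shift ν y) ν : ℕ) = ((y ν).val + 1) % N ν from shift_apply_val ν y, ZMod.natCast_mod]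
  push_cast; rfl

variable [∀ μ, NeZero (N μ)]

/-- the coordinate reading of the backward step: `((y − e_ν)_ν : ℤ∕N_ν) = (y_ν : ℤ∕N_ν) + (−1)`. [folklore]
[cite: Balaban1985BackgroundPropagators, (3.1) p.390] -/
theorem cast_unshift_self (ν : Fin d) (y : TSite d N) :
    (((unshift ν y) ν : ℕ) : ZMod (N ν)) = ((y ν : ℕ) : ZMod (N ν)) + (-1) := by
  have hP : 1 ≤ N ν := Nat.one_le_iff_ne_zero.mpr (NeZero.ne _)
  rw [show ((unshift ν y) ν : ℕ) = ((y ν).val + (N ν - 1)) % N ν from unshift_apply_val ν y, ZMod.natCast_mod]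
  push_cast [Nat.cast_sub hP]
  simp

/-- **ONE STEP FORWARD COSTS `e^{a}` ON THE WEIGHT**: `W_{x₀}(y + e_ν) ≤ e^{a}·W_{x₀}(y)` for the product-`cosh` weight
`W_{x₀}(y) = Π_μ cosh(a·circAbs (N μ) ((x₀)_μ − y_μ).val)` of `B9Eq342GradientRowPureGauge` (`0 ≤ a`). [folklore] [cite: Balaban1984PropagatorsI, p.36;
Balaban1985BackgroundPropagators, Thm 3.1 (3.42) p.397] -/
theorem weight_site_shift_le {a : ℝ} (ha : 0 ≤ a) (x₀ y : TSite d N) (ν : Fin d) :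
    ∏ μ, Real.cosh (a * (circAbs (N μ) ((((x₀ μ : ℕ) : ZMod (N μ)) - (((shift ν y) μ : ℕ) : ZMod (N μ))).val) : ℝ)) ≤
      Real.exp a * ∏ μ, Real.cosh (a * (circAbs (N μ) ((((x₀ μ : ℕ) : ZMod (N μ)) - ((y μ : ℕ) : ZMod (N μ))).val) : ℝ)) := by
  refine prod_cosh_step_le ha (fun μ => (circAbs (N μ) ((((x₀ μ : ℕ) : ZMod (N μ)) - ((y μ : ℕ) : ZMod (N μ))).val) : ℝ))
    (fun μ => (circAbs (N μ) ((((x₀ μ : ℕ) : ZMod (N μ)) - (((shift ν y) μ : ℕ) : ZMod (N μ))).val) : ℝ)) ν ?_ (fun μ hμ => ?_)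
  · rw [cast_shift_self]
    exact abs_circAbs_val_sub_step_le _ _ 1 (Or.inl rfl)
  · rw [shift_apply_ne hμ]

/-- **ONE STEP BACKWARD COSTS `e^{a}` ON THE WEIGHT**: `W_{x₀}(y − e_ν) ≤ e^{a}·W_{x₀}(y)`. [folklore] [cite: Balaban1984PropagatorsI, p.36;
Balaban1985BackgroundPropagators, Thm 3.1 (3.42) p.397] -/
theorem weight_site_unshift_le {a : ℝ} (ha : 0 ≤ a) (x₀ y : TSite d N) (ν : Fin d) :
    ∏ μ, Real.cosh (a * (circAbs (N μ) ((((x₀ μ : ℕ) : ZMod (N μ)) - (((unshift ν y) μ : ℕ) : ZMod (N μ))).val) : ℝ)) ≤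
      Real.exp a * ∏ μ, Real.cosh (a * (circAbs (N μ) ((((x₀ μ : ℕ) : ZMod (N μ)) - ((y μ : ℕ) : ZMod (N μ))).val) : ℝ)) := by
  refine prod_cosh_step_le ha (fun μ => (circAbs (N μ) ((((x₀ μ : ℕ) : ZMod (N μ)) - ((y μ : ℕ) : ZMod (N μ))).val) : ℝ))
    (fun μ => (circAbs (N μ) ((((x₀ μ : ℕ) : ZMod (N μ)) - (((unshift ν y) μ : ℕ) : ZMod (N μ))).val) : ℝ)) ν ?_ (fun μ hμ => ?_)
  · rw [cast_unshift_self]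
    exact abs_circAbs_val_sub_step_le _ _ (-1) (Or.inr rfl)
  · rw [unshift_apply_ne hμ]

omit [∀ μ, NeZero (N μ)] in
/-- the weight is positive. [folklore] [cite: Balaban1984PropagatorsI, p.36] -/
theorem weight_site_pos (a : ℝ) (x₀ y : TSite d N) :
    0 < ∏ μ, Real.cosh (a * (circAbs (N μ) ((((x₀ μ : ℕ) : ZMod (N μ)) - ((y μ : ℕ) : ZMod (N μ))).val) : ℝ)) :=
  Finset.prod_pos fun _ _ => Real.cosh_pos _

end Lattice

/-! ## §W The `2d`-bond stencil in the weighted currency of the pure-gauge response map -/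

section Stencil

variable {X : Type*} {d : ℕ}

/-- THE STENCIL SUM of the bond weight `w′(x, ν) = B_ν·w(x + e_ν)` at a site `y` — bonds `(y, ν)` (target `y + e_ν`) and `(y − e_ν, ν)` (target `y`) —
is `≤ (γ + 1)·(Σ_ν B_ν)·w y` when one step costs `γ` (`sh ν` = `· + e_ν`, `ush ν` = `· − e_ν`). (kernel G `stencil_sum_le`.) [folklore]
[cite: Balaban1985BackgroundPropagators, Thm 3.1 (3.42) p.397, (3.23) p.394] -/
theorem stencil_sum_le (sh ush : Fin d → X → X) (hsu : ∀ ν y, sh ν (ush ν y) = y) (w : X → ℝ)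
    (B : Fin d → ℝ) (hB : ∀ ν, 0 ≤ B ν) {γ : ℝ} (hγ : ∀ ν y, w (sh ν y) ≤ γ * w y) (y : X) :
    ∑ ν, (B ν * w (sh ν y) + B ν * w (sh ν (ush ν y))) ≤ (γ + 1) * (∑ ν, B ν) * w y := by
  have key : ∀ ν, B ν * w (sh ν y) + B ν * w (sh ν (ush ν y)) ≤ B ν * ((γ + 1) * w y) := fun ν => by
    rw [hsu]
    have h1 : B ν * w (sh ν y) ≤ B ν * (γ * w y) := mul_le_mul_of_nonneg_left (hγ ν y) (hB ν)
    nlinarith [hB ν]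
  calc ∑ ν, (B ν * w (sh ν y) + B ν * w (sh ν (ush ν y))) ≤ ∑ ν, B ν * ((γ + 1) * w y) :=
        Finset.sum_le_sum fun ν _ => key ν
    _ = (γ + 1) * (∑ ν, B ν) * w y := by rw [← Finset.sum_mul]; ring

/-- **(PERT) IN THE WEIGHTED CURRENCY FROM THE NATURAL LETTER** (abstract steps).  Bonds `X × Fin d` (`b = (b₋, ν)`, target `sh ν b₋`), bond weight
`B_{b.2}·w(b₊)`, natural letter with one coefficient `ε^nat ≥ 0` over the `2d` bonds at `y` and a value term, one-step ratio `w (sh ν y) ≤ γ·w y` ⟹ the `hV`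
binder with `ε₁ = ε^nat·((γ + 1)·Σ_ν B_ν)`. (kernel G `pert_of_natural_lattice`.) [folklore] [cite: Balaban1985BackgroundPropagators, Thm 3.1 (3.42) p.397,
(3.23) p.394, (3.43) p.398] -/
theorem pert_of_natural_lattice (sh ush : Fin d → X → X) (hsu : ∀ ν y, sh ν (ush ν y) = y) (w : X → ℝ)
    (B : Fin d → ℝ) (hB : ∀ ν, 0 ≤ B ν) {γ : ℝ} (hγ : ∀ ν y, w (sh ν y) ≤ γ * w y)
    {E : Type*} [SeminormedAddCommGroup E] (D : X × Fin d → E) (V : X × Fin d → X → E) {εn ε₂ N : ℝ} (hεn : 0 ≤ εn)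
    (hnat : ∀ b y, ‖V b y‖ ≤ εn * (∑ ν, (‖D (y, ν)‖ + ‖D (ush ν y, ν)‖)) + ε₂ * N * w y) :
    ∀ M : ℝ, 0 ≤ M → (∀ b, ‖D b‖ ≤ M * (B b.2 * w (sh b.2 b.1))) →
      ∀ b y, ‖V b y‖ ≤ (εn * ((γ + 1) * ∑ ν, B ν) * M + ε₂ * N) * w y := by
  intro M hM hD b y
  have h1 : ∑ ν, (‖D (y, ν)‖ + ‖D (ush ν y, ν)‖) ≤ M * ∑ ν, (B ν * w (sh ν y) + B ν * w (sh ν (ush ν y))) := by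
    rw [Finset.mul_sum]
    refine Finset.sum_le_sum fun ν _ => ?_
    have a1 := hD (y, ν)
    have a2 := hD (ush ν y, ν)
    dsimp only at a1 a2
    linarith
  have h2 := stencil_sum_le sh ush hsu w B hB hγ y
  have h3 : ∑ ν, (‖D (y, ν)‖ + ‖D (ush ν y, ν)‖) ≤ M * ((γ + 1) * (∑ ν, B ν) * w y) :=
    h1.trans (mul_le_mul_of_nonneg_left h2 hM)
  have h4 := mul_le_mul_of_nonneg_left h3 hεn
  calc ‖V b y‖ ≤ εn * (∑ ν, (‖D (y, ν)‖ + ‖D (ush ν y, ν)‖)) + ε₂ * N * w y := hnat b y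
    _ ≤ εn * (M * ((γ + 1) * (∑ ν, B ν) * w y)) + ε₂ * N * w y := by linarith
    _ = (εn * ((γ + 1) * ∑ ν, B ν) * M + ε₂ * N) * w y := by ring

variable {N : Fin d → ℕ} [∀ μ, NeZero (N μ)]

/-- **(PERT) ON THE CHAIN's BONDS, LITERALLY THE `hV` BINDER OF `B9Eq342GradientRowPureGauge.norm_le_of_gradient_response_bootstrap_pureGauge`**: bonds
`Bond d N` (`b₊ = btgt b = shift b.2 b.1`), the product-`cosh` weight `W_{x₀}` at rate `a ≥ 0` written out, ANY non-negative direction constants `B_ν` (e.g. that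
file's explicit `B_ν(t, m, a, N_ν)`): a natural letter `‖V b y‖ ≤ ε^nat·Σ_ν(‖D(y,ν)‖ + ‖D(y − e_ν,ν)‖) + ε₂·N_v·W_{x₀}(y)` gives `hV` with
`ε₁ = ε^nat·((e^{a} + 1)·Σ_ν B_ν)`. [folklore] [cite: Balaban1985BackgroundPropagators, Thm 3.1 (3.42) p.397, (3.23) p.394, (3.43) p.398; Balaban1984PropagatorsI, p.36] -/
theorem pert_of_natural_bond {a : ℝ} (ha : 0 ≤ a) (x₀ : TSite d N) (B : Fin d → ℝ) (hB : ∀ ν, 0 ≤ B ν)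
    {E : Type*} [SeminormedAddCommGroup E] (D : Bond d N → E) (V : Bond d N → TSite d N → E) {εn ε₂ Nv : ℝ} (hεn : 0 ≤ εn)
    (hnat : ∀ b y, ‖V b y‖ ≤ εn * (∑ ν, (‖D (y, ν)‖ + ‖D (unshift ν y, ν)‖)) +
      ε₂ * Nv * ∏ μ, Real.cosh (a * (circAbs (N μ) ((((x₀ μ : ℕ) : ZMod (N μ)) - ((y μ : ℕ) : ZMod (N μ))).val) : ℝ))) :
    ∀ M : ℝ, 0 ≤ M →
      (∀ b : Bond d N, ‖D b‖ ≤ M * (B b.2 * ∏ μ, Real.cosh (a * (circAbs (N μ) ((((x₀ μ : ℕ) : ZMod (N μ)) - ((btgt b μ : ℕ) : ZMod (N μ))).val) : ℝ)))) →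
      ∀ (b : Bond d N) (y : TSite d N), ‖V b y‖ ≤ (εn * ((Real.exp a + 1) * ∑ ν, B ν) * M + ε₂ * Nv) *
        ∏ μ, Real.cosh (a * (circAbs (N μ) ((((x₀ μ : ℕ) : ZMod (N μ)) - ((y μ : ℕ) : ZMod (N μ))).val) : ℝ)) :=
  pert_of_natural_lattice shift unshift shift_unshift
    (fun y => ∏ μ, Real.cosh (a * (circAbs (N μ) ((((x₀ μ : ℕ) : ZMod (N μ)) - ((y μ : ℕ) : ZMod (N μ))).val) : ℝ)))
    B hB (fun ν y => weight_site_shift_le ha x₀ y ν) D V hεn hnat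

end Stencil

/-! ## §T The contraction binder in the weighted currency is met by ONE t-free mass choice -/

section Tfree

/-- `θ = |t|·ε₁ = ε^nat·(γ + 1)·Σ_ν |t|·B_ν ≤ ε^nat·(γ₀ + 1)·(d·C)` from the per-direction t-free letter `|t|·B_ν ≤ C`
(`B9Eq342GradientRowComparisonMassUniform.mul_weighted_row_le_uniform`: `C = C_W(m, κ, L)`) and `γ ≤ γ₀` (§C: `e^{κ∕t} ≤ e^{κ}`). (kernel G `theta_le`.)
[folklore] [cite: Balaban1985BackgroundPropagators, Thm 3.1 (3.42) p.397] -/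
theorem theta_le {d : ℕ} (B : Fin d → ℝ) {t εn γ γ₀ C : ℝ} (hεn : 0 ≤ εn) (hγ : 0 ≤ γ + 1) (hγ₀ : γ ≤ γ₀) (hC : 0 ≤ C)
    (hBt : ∀ ν, |t| * B ν ≤ C) :
    |t| * (εn * ((γ + 1) * ∑ ν, B ν)) ≤ εn * (γ₀ + 1) * ((d : ℝ) * C) := by
  have h1 : |t| * ∑ ν, B ν ≤ (d : ℝ) * C := by
    rw [Finset.mul_sum]
    calc ∑ ν, |t| * B ν ≤ ∑ _ν : Fin d, C := Finset.sum_le_sum fun ν _ => hBt ν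
      _ = (d : ℝ) * C := by simp
  have h2 : εn * (γ + 1) * (|t| * ∑ ν, B ν) ≤ εn * (γ + 1) * ((d : ℝ) * C) :=
    mul_le_mul_of_nonneg_left h1 (mul_nonneg hεn hγ)
  have h3 : εn * (γ + 1) * ((d : ℝ) * C) ≤ εn * (γ₀ + 1) * ((d : ℝ) * C) :=
    mul_le_mul_of_nonneg_right (mul_le_mul_of_nonneg_left (by linarith) hεn) (mul_nonneg (Nat.cast_nonneg d) hC)
  calc |t| * (εn * ((γ + 1) * ∑ ν, B ν)) = εn * (γ + 1) * (|t| * ∑ ν, B ν) := by ring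
    _ ≤ εn * (γ₀ + 1) * ((d : ℝ) * C) := h2.trans h3

/-- ONE t-FREE MASS CHOICE: `C ≤ K∕√m` (`B9Eq342GradientRowComparisonMassUniform.uniform_const_le_of_two_le` at `m ≥ 2`) and
`2·(ε^nat·(γ₀ + 1)·d·K) ≤ √m` ⟹ `θ ≤ 1∕2`. (kernel G `theta_le_half`.) [folklore] [cite: Balaban1985BackgroundPropagators, Thm 3.1 (3.42) p.397] -/
theorem theta_le_half {θ εn γ₀ dR C K m : ℝ} (hθ : θ ≤ εn * (γ₀ + 1) * (dR * C)) (hpos : 0 ≤ εn * (γ₀ + 1) * dR)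
    (hm : 0 < m) (hCK : C ≤ K / Real.sqrt m) (hmK : 2 * (εn * (γ₀ + 1) * dR * K) ≤ Real.sqrt m) : θ ≤ 1 / 2 := by
  have hs : 0 < Real.sqrt m := Real.sqrt_pos.mpr hm
  have h1 : εn * (γ₀ + 1) * dR * C ≤ εn * (γ₀ + 1) * dR * (K / Real.sqrt m) := mul_le_mul_of_nonneg_left hCK hpos
  have h2 : εn * (γ₀ + 1) * dR * (K / Real.sqrt m) ≤ 1 / 2 := by
    rw [mul_div_assoc', div_le_iff₀ hs]; linarith
  calc θ ≤ εn * (γ₀ + 1) * (dR * C) := hθ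
    _ = εn * (γ₀ + 1) * dR * C := by ring
    _ ≤ 1 / 2 := h1.trans h2

/-- **THE WEIGHTED CONTRACTION BINDER, η-UNIFORM**: `t ≥ 1`, `κ ≥ 0`, `ε^nat ≥ 0`, the t-free letter `|t|·B_ν ≤ C ≤ K∕√m` (`m > 0`) and the mass choice
`2·ε^nat·(e^{κ} + 1)·d·K ≤ √m` ⟹ `|t|·(ε^nat·((e^{κ∕t} + 1)·Σ_ν B_ν)) < 1` — the `hθ` of the bootstrap for §W's `ε₁` at the rate `a = κ∕t`, for EVERY such
`t`. (kernel G `weighted_junction_uniform`.) [folklore] [cite: Balaban1985BackgroundPropagators, Thm 3.1 (3.42) p.397] -/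
theorem weighted_junction_uniform {d : ℕ} (B : Fin d → ℝ) {t κ εn C K m : ℝ} (ht : 1 ≤ t) (hκ : 0 ≤ κ) (hεn : 0 ≤ εn)
    (hC : 0 ≤ C) (hBt : ∀ ν, |t| * B ν ≤ C) (hm : 0 < m) (hCK : C ≤ K / Real.sqrt m)
    (hmK : 2 * (εn * (Real.exp κ + 1) * (d : ℝ) * K) ≤ Real.sqrt m) :
    |t| * (εn * ((Real.exp (κ / t) + 1) * ∑ ν, B ν)) < 1 := by
  have hγ : 0 ≤ Real.exp (κ / t) + 1 := by positivity
  have hθ := theta_le B hεn hγ (exp_div_le_exp hκ ht) hC hBt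
  have hpos : 0 ≤ εn * (Real.exp κ + 1) * (d : ℝ) := by positivity
  exact (theta_le_half hθ hpos hm hCK hmK).trans_lt (by norm_num)

/-- the same with `‖(t : ℂ)‖` for `|t|` — the letter shape of `B9Eq342GradientRowPureGauge.norm_le_of_gradient_response_bootstrap_pureGauge`'s `hθ`.
[folklore] [cite: Balaban1985BackgroundPropagators, Thm 3.1 (3.42) p.397] -/
theorem weighted_junction_uniform_complex {d : ℕ} (B : Fin d → ℝ) {t κ εn C K m : ℝ} (ht : 1 ≤ t) (hκ : 0 ≤ κ) (hεn : 0 ≤ εn)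
    (hC : 0 ≤ C) (hBt : ∀ ν, ‖(t : ℂ)‖ * B ν ≤ C) (hm : 0 < m) (hCK : C ≤ K / Real.sqrt m)
    (hmK : 2 * (εn * (Real.exp κ + 1) * (d : ℝ) * K) ≤ Real.sqrt m) :
    ‖(t : ℂ)‖ * (εn * ((Real.exp (κ / t) + 1) * ∑ ν, B ν)) < 1 := by
  rw [Complex.norm_real] at hBt ⊢
  exact weighted_junction_uniform B ht hκ hεn hC hBt hm hCK hmK

end Tfree


end Literature.MathematicalPhysics.QuantumFieldTheory.Balaban1983to89.B9Eq342GradientRowNaturalPerturbation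

end
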